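import Summits.CriticalPhenomena.PercolationContinuityZ3.Theorems.PercNearOneGluingNoHeavyPcintNawFreeZ5F10Defs1
import Summits.CriticalPhenomena.PercolationContinuityZ3.Theorems.PercNearOneGluingNoHeavyPcintNawFreeZ5F10Defs2
import Summits.CriticalPhenomena.PercolationContinuityZ3.Theorems.PercNearOneGluingNoHeavyPcintNawRandMemKernelSymTab
import HarnessLib

/-!
# PCINT lane, kernel reduced-state B2d (`nawfree`) certificate `Z5F10` (d = 5, memory τ = 10, delay kt = 4, 798 state classes): table root, symmetry table, parameters

Cell `prim-pcint`, seat `prim-pcint-1` (gen 6); memo `run/shared/lean/prim/pcint/REDUCTIONS.md` §B2d (delayed chain payments with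
free-neighbour shares).  Does NOT build on p205010.  Data for `NawK.le_siteCriticalProb_of_checkRowsF` (`…PcintNawFreeMemKernelCert`):
`p = 12690/100000`, weight table `Q_k/100000`, `Q = [87310, 87310, 93440, 95578, 96665, 97323, 97764, 98081, 98318, 98504, 98653]` (`Q_k^k·100000 ≥ (100000-12690)·100000^k`, nondecreasing), `λ = 99999/100000`; Collatz–Wielandt
weights (scale 10⁹) from a power iteration, exact off-line max row ratio 0.9993694106 < λ.  Generated by work/gen6/gen_free.py
(pcint-1 gen 6 folder); the kernel re-checks every row.
-/

noncomputable section

namespace Summit.CriticalPhenomena.PercolationContinuityZ3.Theorems.Pcint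

namespace NawFreeZ5F10

set_option maxRecDepth 8000 in
/-- The certificate table (search tree keyed by row index). [folklore] -/
def tree : NawK.NT := (NawK.NT.node t_0_399 399 (614988034, [([-1,-1,-2,-1,0], 5), ([-1,-1,-2,0,0], 4), ([-1,-1,-1,0,0], 3), ([-1,-1,0,0,0], 2), ([-1,0,-2,-1,0], 6), ([-1,0,-1,-1,0], 7), ([-1,0,0,0,0], 1)], [some (38, 0), none, some (39, 2), none, some (40, 4), some (662, 5), some (42, 6), some (663, 7), some (42, 8), some (42, 9)]) t_400_798)

/-- The 10 signed permutations of `ℤ^5` used by the certificate, as tables. [folklore] -/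
def syms : List (List (ℕ × Bool)) := [[(0, true), (1, true), (2, true), (3, true), (4, true)], [(0, false), (1, true), (2, true), (3, true), (4, true)], [(1, true), (0, true), (2, true), (3, true), (4, true)], [(1, true), (0, false), (2, true), (3, true), (4, true)], [(1, true), (2, true), (0, true), (3, true), (4, true)], [(1, true), (2, true), (0, false), (3, true), (4, true)], [(1, true), (2, true), (3, true), (0, true), (4, true)], [(1, true), (2, true), (3, true), (0, false), (4, true)], [(1, true), (2, true), (3, true), (4, true), (0, true)], [(1, true), (2, true), (3, true), (4, true), (0, false)]]

/-- Every table is a valid signed permutation table. [folklore] -/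
theorem syms_valid : syms.all (NawK.validTab 5) = true := by decide +kernel

/-- The weight table (numerators over the denominator). [folklore] -/
def QL : List ℕ := [87310, 87310, 93440, 95578, 96665, 97323, 97764, 98081, 98318, 98504, 98653]

/-- The row check of this certificate. [folklore] -/
def chk (i : ℕ) : Bool := NawK.checkRowF 10 4 5 798 12690 100000 99999 100000 QL syms tree i

end NawFreeZ5F10

end Summit.CriticalPhenomena.PercolationContinuityZ3.Theorems.Pcint
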